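import Literature.NumberTheory.ComplexMultiplication.CMTypeCount
import Literature.NumberTheory.ComplexMultiplication.CMTypeTorusEndomorphisms
import Literature.AlgebraicGeometry.ComplexMultiplication.CMTorusImaginaryQuadratic
import HarnessLib

/-!
# The CM elliptic curves `ℂ/Φ(𝔞)` of an imaginary quadratic field and the Gaussian torus `ℂ/ℤ[i]`
# (Layer-A validation instances)

Sequel of `CMTorusImaginaryQuadratic.lean` (the dimension counts at `[K:ℚ] = 2`) and
`NumberTheory/ComplexMultiplication/CMTypeCount.lean` (imaginary quadratic fields are CM; `ℚ(i) =
CyclotomicField 4 ℚ`; its CM types `{φ}`): the VALIDATION INSTANCES "for `(ℚ(i), {id}, 𝔞 = ℤ[i])` this is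
the torus `ℂ/ℤ[i]` … dimension `= card Φ`; `End ⊗ ℚ ⊇ K`", "`h^{1,0} = 1`", "MT … of rank 2" of the
`lit-hodgefound` Layer-A tribunal (TRIBUNAL-A §2, A3), obtained from the tree's general theorems
(Shimura, *Abelian Varieties with Complex Multiplication and Modular Functions* (1998) §6.1 Thm 2, §6.2
Thms 3–4; Deligne, LNM 900, Ex. 3.7):

* `isAbelianVariety_periodIso_of_finrank_eq_two` — for a totally complex quadratic field `K` (no `IsCMField`
  instance assumed: it is DERIVED, `CMTypeCount.isCMField_of_finrank_eq_two`), every CM type `Φ` and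
  fractional ideal `I`, the torus `ℂ^Φ/Φ(I)` is an abelian variety (a CM elliptic curve);
* `gaussian_isAbelianVariety` — **`ℂ/ℤ[i]` is an abelian variety** (`K = ℚ(i)`, `Φ = {φ}`, `I = 1`, lattice
  `Φ(1) = v(ℤ[i])` by `idealLattice_one_eq_integerLattice`); `gaussian_dim` — `#Φ = 1`, `dim_ℝ = 2`,
  `rank_ℤ ℤ[i] = 2`; `gaussian_ringOfIntegers_action` — `ℤ[i] ↪ End(ℂ/ℤ[i])` by holomorphic maps
  (complex multiplication by `i`); `gaussian_hodgeNumber_one_zero` — `h^{1,0} = 1`;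
  `gaussian_mtRank` — `dim MT(V¹_{(ℚ(i),{φ})}) = 2` (the torus `Res_{ℚ(i)/ℚ} 𝔾_m`).

Everything is PROVED (theorems only; no definition, no named fact).  NOT here: `ℂ/ℤ[i] ≅ E(ℂ)` for the
Weierstrass curve `y² = x³ − x` (no uniformisation of elliptic curves in Mathlib).

## References

* [Shimura1998] G. Shimura, *Abelian Varieties with Complex Multiplication and Modular Functions* (1998),
  §6.1 Thm 2 (p. 41), §6.2 Thms 3–4 (pp. 42–45), §8.4 Example (1).
* [Deligne1982HodgeCycles] P. Deligne, *Hodge cycles on abelian varieties*, LNM 900 (1982), I Ex. 3.7.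
* [GreenGriffithsKerr2012] M. Green, P. Griffiths, M. Kerr, *Mumford–Tate Groups and Domains* (2012), §V.B.

## Provenance

Lane `lit-hodgefound` (Hodge path, Track 2), Layer-A skeleton seat `lit-hodgefound-skel-3`, validation rows
V6–V8 of `HOME/lit-hodgefound-skel-3/SKELETON-A3.md` (Gaussian half).
-/

noncomputable section

open scoped Classical nonZeroDivisors Manifold ContDiff
open NumberField NumberField.InfinitePlace NumberField.ComplexEmbedding Module

namespace Literature.AlgebraicGeometry.ComplexMultiplication

open Literature.AlgebraicGeometry.Motives (CMType HodgeTensorFacts)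
open Literature.AlgebraicGeometry.Motives.HodgeStructure (ofCMType)
open Literature.NumberTheory.ComplexMultiplication
open Literature.NumberTheory.ComplexMultiplication.CMTypeCount (single GaussianField gaussianCMType
  finrank_gaussianField isCMField_of_finrank_eq_two)
open Literature.Geometry.Kaehler

namespace CMTorusImaginaryQuadratic

/-! ## §1 Imaginary quadratic fields: `ℂ/Φ(I)` is a CM elliptic curve -/

section Quadratic

variable {K : Type} [Field K] [NumberField K] [IsTotallyComplex K] (h2 : finrank ℚ K = 2)
include h2

/-- **CM elliptic curves: for a totally complex quadratic field `K`, a CM type `Φ` and a fractional ideal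
`I`, the complex torus `ℂ^Φ/Φ(I)` (complex dimension `1`) is an abelian variety** — Shimura's Theorem 3
(`CMTypeLattice.isAbelianVariety_periodIso`, Riemann form `E(v(α),v(β)) = Tr_{K/ℚ}(ζ α β̄)`) at `n = 1`,
`K` being a CM field by `CMTypeCount.isCMField_of_finrank_eq_two`. [cite: Shimura1998, §6.2 Thm. 3–4, pp. 42–45] -/
theorem isAbelianVariety_periodIso_of_finrank_eq_two (Φ : CMType K) (I : (FractionalIdeal (𝓞 K)⁰ K)ˣ) :
    ComplexTorus.IsAbelianVariety (CMTypeLattice.periodIso Φ I) := by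
  haveI := isCMField_of_finrank_eq_two h2
  exact CMTypeLattice.isAbelianVariety_periodIso Φ I

end Quadratic

/-! ## §2 The Gaussian torus `ℂ/ℤ[i]` -/

section Gaussian

/-- **`ℂ/ℤ[i]` is an abelian variety**: the CM torus of `(ℚ(i); {φ})` and the unit ideal `ℤ[i] = 𝓞_{ℚ(i)}`
(its lattice is `v(ℤ[i])`, `idealLattice_one_eq_integerLattice`). [cite: Shimura1998, §6.2 Thm. 3–4, pp. 42–45] -/
theorem gaussian_isAbelianVariety (φ : GaussianField →+* ℂ) :
    ComplexTorus.IsAbelianVariety (CMTypeLattice.periodIso (gaussianCMType φ) 1) :=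
  CMTypeLattice.isAbelianVariety_periodIso _ 1

/-- `ℂ/ℤ[i]` has complex dimension `1 = #Φ` (real dimension `2`) and its lattice has rank `2`.
[cite: Shimura1998, §6.2, proof of Thm. 3, p. 42] -/
theorem gaussian_dim (φ : GaussianField →+* ℂ) :
    Fintype.card (gaussianCMType φ).1 = 1 ∧ finrank ℝ ((gaussianCMType φ).1 → ℂ) = 2 ∧
      finrank ℤ (CMTypeLattice.idealLattice (gaussianCMType φ) 1) = 2 :=
  ⟨card_cmType_eq_one finrank_gaussianField _, finrank_real_pi_eq_two finrank_gaussianField _,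
    finrank_idealLattice_eq_two finrank_gaussianField _ 1⟩

/-- **`ℤ[i] ↪ End(ℂ/ℤ[i])` by holomorphic endomorphisms** ("complex multiplication by `i`"; "End ⊗ ℚ ⊇ K"):
`a ↦ ι(a)` is an injective ring homomorphism into the integer matrices of the lattice, and each `ι(a)` is a
holomorphic self-map of the torus with analytic representation `φ(a)` — the tree's
`CMTypeLattice.mulMatrixHom_injective` / `contMDiff_mapMatrix_mulMatrix` at `ℚ(i)`.
[cite: Shimura1998, §6.1 Thm. 2 (p. 41)] -/
theorem gaussian_ringOfIntegers_action (φ : GaussianField →+* ℂ) :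
    Function.Injective (CMTypeLattice.mulMatrixHom (K := GaussianField) 1) ∧
      ∀ a : 𝓞 GaussianField, ContMDiff 𝓘(ℂ, (gaussianCMType φ).1 → ℂ) 𝓘(ℂ, (gaussianCMType φ).1 → ℂ) ω
        (ComplexTorus.mapMatrix (CMTypeLattice.periodIso (gaussianCMType φ) 1)
          (CMTypeLattice.periodIso (gaussianCMType φ) 1) (CMTypeLattice.mulMatrix 1 a)) :=
  ⟨CMTypeLattice.mulMatrixHom_injective 1, fun a => CMTypeLattice.contMDiff_mapMatrix_mulMatrix _ 1 a⟩

/-- `h^{1,0}(V¹_{(ℚ(i),{φ})}) = 1`. [cite: GreenGriffithsKerr2012, §V.B–V.C] -/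
theorem gaussian_hodgeNumber_one_zero (φ : GaussianField →+* ℂ) :
    (ofCMType (gaussianCMType φ)).hodgeNumber 1 0 = 1 :=
  hodgeNumber_one_zero_eq_one finrank_gaussianField _

/-- **`dim MT(V¹_{(ℚ(i),{φ})}) = 2`**: the Mumford–Tate group of the CM elliptic curve `ℂ/ℤ[i]` is the rank-2
torus `Res_{ℚ(i)/ℚ} 𝔾_m` (dimension count). [cite: Deligne1982HodgeCycles, I Ex. 3.7] -/
theorem gaussian_mtRank [HodgeTensorFacts.{0, 0}] (φ : GaussianField →+* ℂ) :
    (ofCMType (gaussianCMType φ)).mtRank = 2 :=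
  mtRank_ofCMType_eq_two finrank_gaussianField _

end Gaussian

end CMTorusImaginaryQuadratic

end Literature.AlgebraicGeometry.ComplexMultiplication

end
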